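import Literature.MathematicalPhysics.QuantumLattice.FermionOperatorsProofs
import Literature.MathematicalPhysics.QuantumLattice.HubbardHubbardModelEtaODLROProofs
import Literature.MathematicalPhysics.QuantumLattice.HubbardModelProofs
import Literature.MathematicalPhysics.QuantumLattice.HubbardNNNHoppingRectSymmetries
import Literature.MathematicalPhysics.QuantumLattice.HubbardOneParticleCost
import Literature.MathematicalPhysics.QuantumLattice.HubbardRingPerronFrobeniusProofs
import Literature.MathematicalPhysics.QuantumLattice.HubbardSzSectorLadder
import Literature.MathematicalPhysics.QuantumLattice.HubbardWave0LiebProofs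
import Literature.MathematicalPhysics.QuantumLattice.SectorEigenvalueContinuation

/-!
# M3: the η-lowest-weight licence — exact ground-state equalities for `t′ = 0` torus rows

HONEST FRAMING: first certified bounds; not a superconductivity verdict; every number
certified or labelled float.

Speedrun `mbsolver`, M3 canonical point (`U = 8t`, `n = 7/8`, `t′ ∈ {0, −1/4}`); stripe-definitions
seat sr-mbsolver-m3-4, memo `run/shared/lean/speedrun/mbsolver/sr-mbsolver-m3-4/ETA-LICENCE.md`.

On a finite BIPARTITE hopping graph `G` (a sign `ε : Λ → ℤˣ` with `ε x = -ε y` on every edge: the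
`4×4` torus, the `8×2` ladder, every `L₁×L₂` torus with both sides even) the pure nearest-neighbour
Hubbard Hamiltonian `H = hamiltonian G t U` (`t′ = 0`) obeys Yang's `[H, η†_ε] = U η†_ε`
(`hamiltonian_commutator_etaRaise`).  LICENCE ⇒ CONSTRAINT: if the sector ground energies satisfy
the STRICT pair-addition inequality `E(2n+2, S^z = 0) < E(2n, S^z = 0) + U`, then every ground
state `ψ` of the sector `(2n+2, 0)` is annihilated by `η_ε = (η†_ε)ᴴ`
(`etaLower_mulVec_eq_zero_of_pairGap`; `N`-sector form for any `S^z` and any parity of `N`: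
`etaLower_mulVec_eq_zero_of_groundEnergyAt_lt`), hence `⟨ψ, (Z η + η† Z') ψ⟩ = 0` for ALL operators `Z, Z'`
(`expect_etaIdeal_eq_zero`): exact linear equalities on the ground-state moment functional which do
NOT hold on the whole sector (η-raised eigenvectors `η† φ` violate them) — admissible extra ideal
rows for a sector SDP certificate at `t′ = 0`.  The licence is discharged by two CERTIFIED numbers,
an upper bound on `E(2n+2)` and a lower bound on `E(2n)` (`etaLower_mulVec_eq_zero_of_certified`).
At `t′ ≠ 0` the next-nearest-neighbour hopping joins equal-sign sites, `[H, η†] ≠ U η†`, and there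
is no licence; in the thermodynamic limit the constraint is a conditionally convergent lattice sum
and is not window-expressible — the device is for finite tori / clusters only.

Provenance: criterion and proof follow the crux sketch
`Summits/HubbardSuperconductivity/HubbardSuperconductivity/Cruxes/MesoscopicPairOrder/SketchIdeator4.lean`
(`lowestWeightCriterion_holds`, square tori `hubbardTorus 2 L 1 U`, 2026-08-17); re-homed here in the
general bipartite-graph form over the objects the cell's certified rows use (`hamiltonian G t U`,
`groundEnergyAt G t U N`).  Yang, PRL 63 (1989) 2144, eqs. (4)–(6); Essler–Frahm–Göhmann–Klümper–
Korepin (2005) §2.2.5.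
-/

namespace Summit.Ventures.CertifiedManyBodySolver.M3

open Matrix Finset
open Literature.MathematicalPhysics.QuantumLattice
open Literature.MathematicalPhysics.QuantumLattice.EigenvalueContinuation (re_star_dotProduct_self_pos)
open scoped BigOperators Matrix ComplexOrder

variable {Λ : Type*} [LinearOrder Λ] [Fintype Λ] (G : SimpleGraph Λ) [DecidableRel G.Adj]

/-- Yang's commutator in the two forms used below: `H η† = U η† + η† H` and, taking adjoints
(`H` Hermitian, `U` real), `H η = η H − U η`. -/
theorem hamiltonian_mul_etaLower (ε : Λ → ℤˣ) (hε : ∀ x y, G.Adj x y → ε x = -ε y) (t U : ℝ) :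
    hamiltonian G t U * etaRaise ε = (U : ℂ) • etaRaise ε + etaRaise ε * hamiltonian G t U ∧
      hamiltonian G t U * etaLower ε = etaLower ε * hamiltonian G t U - (U : ℂ) • etaLower ε := by
  set H := hamiltonian G t U with hH
  have hcomm := hamiltonian_commutator_etaRaise G ε hε t U
  have hHerm : Hᴴ = H := (hamiltonian_isHermitian_and_commute_holds G t U).1.eq
  have h1 : H * etaRaise ε = (U : ℂ) • etaRaise ε + etaRaise ε * H := sub_eq_iff_eq_add.1 hcomm
  have h2 : etaLower ε * H = (U : ℂ) • etaLower ε + H * etaLower ε := by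
    have := congrArg Matrix.conjTranspose h1
    simpa [Matrix.conjTranspose_mul, Matrix.conjTranspose_add, Matrix.conjTranspose_smul, hHerm,
      etaLower, Complex.star_def, Complex.conj_ofReal] using this
  exact ⟨h1, by rw [h2]; abel⟩

/-- The pseudospin Casimir part `η† η` commutes with `H` on a bipartite graph at EVERY filling:
`[H, η†η] = [H, η†] η + η† [H, η] = U η†η − U η†η = 0`.  (So the lowest-weight subspace
`ker η ∩ sector` is `H`-invariant: a legitimate refined sector.) -/
theorem hamiltonian_commute_etaRaise_mul_etaLower (ε : Λ → ℤˣ)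
    (hε : ∀ x y, G.Adj x y → ε x = -ε y) (t U : ℝ) :
    Commute (hamiltonian G t U) (etaRaise ε * etaLower ε) := by
  obtain ⟨h1, h3⟩ := hamiltonian_mul_etaLower G ε hε t U
  show hamiltonian G t U * (etaRaise ε * etaLower ε) = etaRaise ε * etaLower ε * hamiltonian G t U
  rw [← mul_assoc, h1, add_mul, smul_mul_assoc, mul_assoc, h3, mul_sub, mul_smul_comm, ← mul_assoc]
  abel

/-- **The η-lowest-weight licence.**  On a finite bipartite graph, if the `S^z = 0` sector ground
energies satisfy `E(2n+2, 0) < E(2n, 0) + U` (strict pair-addition inequality), then every ground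
state `ψ` of the sector `(2n+2, S^z = 0)` is annihilated by Yang's `η_ε = Σ_x ε_x c_{x↓} c_{x↑}`.
Proof: `η ψ` lies in the sector `(n, n)` and is an eigenvector of `H` with eigenvalue
`E(2n+2,0) − U` (Yang's commutator); the sector variational principle gives
`⟨ηψ, H ηψ⟩ ≥ E(2n,0) ‖ηψ‖²`, so `(E(2n,0) − E(2n+2,0) + U) ‖ηψ‖² ≤ 0` with a positive bracket. -/
theorem etaLower_mulVec_eq_zero_of_pairGap (ε : Λ → ℤˣ) (hε : ∀ x y, G.Adj x y → ε x = -ε y)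
    (t U : ℝ) {n : ℕ} (hn : n ≤ Fintype.card Λ)
    (hgap : (hamiltonian G t U).minEnergyOn (szSector (2 * (n + 1)) 0) <
        (hamiltonian G t U).minEnergyOn (szSector (2 * n) 0) + U)
    {ψ : Fock (Orb Λ)} (hψ : IsGroundStateInSector (hamiltonian G t U) (2 * (n + 1)) 0 ψ) :
    etaLower ε *ᵥ ψ = 0 := by
  set H := hamiltonian G t U with hH
  obtain ⟨hψS, hψ0, hHψ⟩ := hψ
  have hψsec : IsInSector (n + 1) (n + 1) ψ := (mem_szSector_two_mul_zero_iff (n + 1) ψ).1 hψS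
  set E₂ : ℝ := H.minEnergyOn (szSector (2 * (n + 1)) 0) with hE₂
  set E₀ : ℝ := H.minEnergyOn (szSector (2 * n) 0) with hE₀
  set φ : Fock (Orb Λ) := etaLower ε *ᵥ ψ with hφ
  -- (1) `φ = ηψ` lies in the sector `(n, n)`
  have hφsec : IsInSector n n φ := by
    rw [hφ, etaLower_eq_sum_holds, sum_mulVec]
    refine Finset.sum_induction _ (fun v => IsInSector n n v) (fun a b ha hb => ha.add hb)
      (IsInSector.zero n n) fun x _ => ?_
    rw [smul_mulVec, ← mulVec_mulVec]
    exact ((hψsec.annihilation_up_mulVec x).annihilation_down_mulVec x).smul _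
  -- (2) Yang's commutator, lowered: `H η = η H - U η`
  have h3 := (hamiltonian_mul_etaLower G ε hε t U).2
  -- (3) `φ` is an eigenvector with eigenvalue `E₂ - U`
  have hHφ : H *ᵥ φ = ((E₂ - U : ℝ) : ℂ) • φ := by
    show H *ᵥ (etaLower ε *ᵥ ψ) = ((E₂ - U : ℝ) : ℂ) • (etaLower ε *ᵥ ψ)
    rw [mulVec_mulVec, h3, sub_mulVec, smul_mulVec, ← mulVec_mulVec, hHψ, mulVec_smul, ← sub_smul]
    congr 1
    push_cast
    ring
  have hexp : (expect H φ).re = (E₂ - U) * (star φ ⬝ᵥ φ).re := by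
    rw [Literature.MathematicalPhysics.QuantumLattice.expect, hHφ, dotProduct_smul, smul_eq_mul,
      Complex.re_ofReal_mul]
  -- (4) variational principle in the sector `(n, n)`
  have hvar := (szSector_groundState G t U hn).2 φ hφsec
  rw [hexp] at hvar
  -- (5) conclude: `(E₀ - E₂ + U) ‖φ‖² ≤ 0` with a positive bracket
  by_contra hφ0
  have hpos := re_star_dotProduct_self_pos hφ0
  have hgap' : 0 < E₀ - E₂ + U := by rw [hE₀, hE₂]; linarith
  nlinarith

/-- The same licence stated over the cell's row objects `groundEnergyAt G t U N` (the `N`-particle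
ground energy; it equals the `S^z = 0` sector minimum by `groundEnergyAt_eq_minEnergyOn_szSector`). -/
theorem etaLower_mulVec_eq_zero_of_groundEnergyAt_gap (ε : Λ → ℤˣ)
    (hε : ∀ x y, G.Adj x y → ε x = -ε y) (t U : ℝ) {n : ℕ} (hn : n + 1 ≤ Fintype.card Λ)
    (hgap : groundEnergyAt G t U (2 * (n + 1)) < groundEnergyAt G t U (2 * n) + U)
    {ψ : Fock (Orb Λ)} (hψ : IsGroundStateInSector (hamiltonian G t U) (2 * (n + 1)) 0 ψ) :
    etaLower ε *ᵥ ψ = 0 := by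
  have hn0 : n ≤ Fintype.card Λ := by omega
  rw [groundEnergyAt_eq_minEnergyOn_szSector G t U hn, groundEnergyAt_eq_minEnergyOn_szSector G t U hn0]
    at hgap
  exact etaLower_mulVec_eq_zero_of_pairGap G ε hε t U hn0 hgap hψ

/-- **Discharge by certificates.**  The licence inequality follows from a certified UPPER bound
`groundEnergyAt G t U (2n+2) ≤ u` (e.g. an exact Rayleigh quotient) and a certified LOWER bound
`l ≤ groundEnergyAt G t U (2n)` (e.g. an SDP certificate in the sector `(n, n)`) with `u < l + U`. -/
theorem etaLower_mulVec_eq_zero_of_certified (ε : Λ → ℤˣ)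
    (hε : ∀ x y, G.Adj x y → ε x = -ε y) (t U : ℝ) {n : ℕ} (hn : n + 1 ≤ Fintype.card Λ)
    {u l : ℝ} (hu : groundEnergyAt G t U (2 * (n + 1)) ≤ u) (hl : l ≤ groundEnergyAt G t U (2 * n))
    (hul : u < l + U)
    {ψ : Fock (Orb Λ)} (hψ : IsGroundStateInSector (hamiltonian G t U) (2 * (n + 1)) 0 ψ) :
    etaLower ε *ᵥ ψ = 0 :=
  etaLower_mulVec_eq_zero_of_groundEnergyAt_gap G ε hε t U hn (by linarith) hψ

/-- **`N`-sector form (any `S^z`), matching the hypotheses of the tree's annihilator-row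
certificate theorem `re_dotProduct_ge_of_sector_certificate_annihilators`.**  If
`E₀(N+2) < E₀(N) + U` for the `N`-particle ground energies `groundEnergyAt G t U ·`, then every
`(N+2)`-particle ground vector `ψ` (`H ψ = E₀(N+2) ψ`; no `S^z` or parity assumption on `N`) is
annihilated by `η_ε`: `η ψ` is an `N`-particle vector with `⟨ηψ, H ηψ⟩ = (E₀(N+2) − U) ‖ηψ‖²`, and
the `N`-particle variational bound `E₀(N) ‖ηψ‖² ≤ ⟨ηψ, H ηψ⟩` forces `ηψ = 0`. -/
theorem etaLower_mulVec_eq_zero_of_groundEnergyAt_lt (ε : Λ → ℤˣ)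
    (hε : ∀ x y, G.Adj x y → ε x = -ε y) (t U : ℝ) {N : ℕ}
    (hgap : groundEnergyAt G t U (N + 2) < groundEnergyAt G t U N + U)
    {ψ : Fock (Orb Λ)} (hψN : IsNParticle (N + 2) ψ)
    (hHψ : hamiltonian G t U *ᵥ ψ = ((groundEnergyAt G t U (N + 2) : ℝ) : ℂ) • ψ) :
    etaLower ε *ᵥ ψ = 0 := by
  set H := hamiltonian G t U with hH
  set E₂ : ℝ := groundEnergyAt G t U (N + 2) with hE₂
  set E₀ : ℝ := groundEnergyAt G t U N with hE₀
  set φ : Fock (Orb Λ) := etaLower ε *ᵥ ψ with hφ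
  -- (1) `φ = ηψ` is an `N`-particle vector
  have hφN : IsNParticle N φ := by
    rw [hφ, etaLower_eq_sum_holds, sum_mulVec]
    rw [← mem_nParticleSubmodule_iff]
    refine Submodule.sum_mem _ fun x _ => ?_
    rw [smul_mulVec, ← mulVec_mulVec]
    refine Submodule.smul_mem _ _ ?_
    rw [mem_nParticleSubmodule_iff]
    exact IsNParticle.annihilation_mulVec_holds (IsNParticle.annihilation_mulVec_holds hψN _) _
  -- (2) Yang's commutator, lowered, makes `φ` an eigenvector with eigenvalue `E₂ - U`
  have h3 := (hamiltonian_mul_etaLower G ε hε t U).2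
  have hHφ : H *ᵥ φ = ((E₂ - U : ℝ) : ℂ) • φ := by
    show H *ᵥ (etaLower ε *ᵥ ψ) = ((E₂ - U : ℝ) : ℂ) • (etaLower ε *ᵥ ψ)
    rw [mulVec_mulVec, h3, sub_mulVec, smul_mulVec, ← mulVec_mulVec, hHψ, mulVec_smul, ← sub_smul]
    congr 1
    push_cast
    ring
  have hexp : (expect H φ).re = (E₂ - U) * (star φ ⬝ᵥ φ).re := by
    rw [Literature.MathematicalPhysics.QuantumLattice.expect, hHφ, dotProduct_smul, smul_eq_mul,
      Complex.re_ofReal_mul]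
  -- (3) the `N`-particle variational bound and the contradiction
  have hvar := ThermodynamicLimit.groundEnergyAt_mul_norm_le G t U hφN
  rw [hexp] at hvar
  by_contra hφ0
  have hpos := re_star_dotProduct_self_pos hφ0
  have hgap' : 0 < E₀ - E₂ + U := by rw [hE₀, hE₂]; linarith
  nlinarith

/-- `N`-sector form discharged by certificates: `E₀(N+2) ≤ u`, `l ≤ E₀(N)`, `u < l + U`. -/
theorem etaLower_mulVec_eq_zero_of_certified' (ε : Λ → ℤˣ)
    (hε : ∀ x y, G.Adj x y → ε x = -ε y) (t U : ℝ) {N : ℕ} {u l : ℝ}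
    (hu : groundEnergyAt G t U (N + 2) ≤ u) (hl : l ≤ groundEnergyAt G t U N) (hul : u < l + U)
    {ψ : Fock (Orb Λ)} (hψN : IsNParticle (N + 2) ψ)
    (hHψ : hamiltonian G t U *ᵥ ψ = ((groundEnergyAt G t U (N + 2) : ℝ) : ℂ) • ψ) :
    etaLower ε *ᵥ ψ = 0 :=
  etaLower_mulVec_eq_zero_of_groundEnergyAt_lt G ε hε t U (by linarith) hψN hHψ

/-- **The certificate slot.**  For an η-annihilated vector `ψ` and ANY operators `Z, Z'`,
`⟨ψ, (Z η + η† Z') ψ⟩ = 0`: the ideal generated by `η` (left) and `η†` (right) is invisible to the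
ground-state functional — these are the admissible extra rows of a `t′ = 0` sector certificate. -/
theorem expect_etaIdeal_eq_zero (ε : Λ → ℤˣ) {ψ : Fock (Orb Λ)} (hη : etaLower ε *ᵥ ψ = 0)
    (Z Z' : Matrix (Finset (Orb Λ)) (Finset (Orb Λ)) ℂ) :
    expect (Z * etaLower ε + etaRaise ε * Z') ψ = 0 := by
  have h1 : etaRaise ε = (etaLower ε)ᴴ := by simp [etaLower]
  rw [Literature.MathematicalPhysics.QuantumLattice.expect, add_mulVec, dotProduct_add,
    ← mulVec_mulVec, hη, mulVec_zero, dotProduct_zero, zero_add, ← mulVec_mulVec, h1,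
    dotProduct_mulVec, ← star_mulVec, hη, star_zero, zero_dotProduct]

/-- In particular the staggered on-site pair structure factor vanishes: `⟨ψ, η† η ψ⟩ = 0`
(`Σ_{x,y} ε_x ε_y ⟨c†_{x↑} c†_{x↓} c_{y↓} c_{y↑}⟩ = 0`, i.e. the double occupancy equals minus the
staggered sum of the on-site pair-hopping correlators) — the single scalar row which, together with
positivity of the moment matrix, already encodes `M v_η = 0` in the charge-`−2`, momentum-`(π,π)` block. -/
theorem expect_etaRaise_mul_etaLower_eq_zero (ε : Λ → ℤˣ) {ψ : Fock (Orb Λ)}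
    (hη : etaLower ε *ᵥ ψ = 0) : expect (etaRaise ε * etaLower ε) ψ = 0 := by
  have := expect_etaIdeal_eq_zero ε hη 0 (etaLower ε)
  simpa using this

/-! ### Instances on the cell's tori (the objects the certificates speak about)

`fermionRectTorusGraph a b` with even sides and Lieb's sign `rectStagger a b` (the 4×4 rows are
`a = b = 4`, `U = 8`, `N + 2 = 14`: `u = -815606355579/2^36`, `l` = the Langer–Mattis sector
certificate at `N = 12`, `u - l = 4.7730180 < 8`), and the square torus `fermionTorusGraph d L`,
`L` even, with Yang's `torusStagger` (the convention of
`hubbardTorus_groundEnergyAt_ge_of_certificate_annihilators`). -/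

/-- Rectangular even torus: certified `E₀(N+2) ≤ u`, `l ≤ E₀(N)`, `u < l + U` ⇒ every `(N+2)`-particle
ground vector is annihilated by `η_{rectStagger}`. -/
theorem rectTorus_etaLower_mulVec_eq_zero_of_certified {a b : ℕ} (ha : Even a) (hb : Even b)
    (t U : ℝ) {N : ℕ} {u l : ℝ}
    (hu : groundEnergyAt (fermionRectTorusGraph a b) t U (N + 2) ≤ u)
    (hl : l ≤ groundEnergyAt (fermionRectTorusGraph a b) t U N) (hul : u < l + U)
    {ψ : Fock (Orb (Fin a ×ₗ Fin b))} (hψN : IsNParticle (N + 2) ψ)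
    (hHψ : hamiltonian (fermionRectTorusGraph a b) t U *ᵥ ψ =
      ((groundEnergyAt (fermionRectTorusGraph a b) t U (N + 2) : ℝ) : ℂ) • ψ) :
    etaLower (rectStagger a b) *ᵥ ψ = 0 :=
  etaLower_mulVec_eq_zero_of_certified' (fermionRectTorusGraph a b) (rectStagger a b)
    (fun _ _ h => rectStagger_eq_neg_of_adj ha hb h) t U hu hl hul hψN hHψ

/-- Square even torus `(ℤ/Lℤ)^d` with Yang's `torusStagger`: same statement. -/
theorem torus_etaLower_mulVec_eq_zero_of_certified {d L : ℕ} [NeZero L] (hL : Even L)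
    (t U : ℝ) {N : ℕ} {u l : ℝ}
    (hu : groundEnergyAt (fermionTorusGraph d L) t U (N + 2) ≤ u)
    (hl : l ≤ groundEnergyAt (fermionTorusGraph d L) t U N) (hul : u < l + U)
    {ψ : Fock (Orb (FermionTorus d L))} (hψN : IsNParticle (N + 2) ψ)
    (hHψ : hamiltonian (fermionTorusGraph d L) t U *ᵥ ψ =
      ((groundEnergyAt (fermionTorusGraph d L) t U (N + 2) : ℝ) : ℂ) • ψ) :
    etaLower (torusStagger (d := d) (L := L)) *ᵥ ψ = 0 :=
  etaLower_mulVec_eq_zero_of_certified' (fermionTorusGraph d L) torusStagger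
    (fun _ _ h => torusStagger_eq_neg_of_adj_holds hL h) t U hu hl hul hψN hHψ

end Summit.Ventures.CertifiedManyBodySolver.M3
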